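import Literature.Computability.Complexity.ScaledPCPDecideN
import Literature.Computability.Complexity.ScaledPCPQueriesFP
import HarnessLib

/-!
# The decision map of the scaled PCP verifier is polynomial time

Literature / complexity toolkit, sixth MACHINE-LAYER brick for `ScaledPCP.verifier' M T`
(`ScaledPCPVerifier.lean`): the residue-level decision `decideN` of `ScaledPCPDecideN.lean`
(`= decideOf`, `decideOf_eq_decideN`) assembled in the typed algebra `CodeFP`, reusing the lifts of
`ScaledPCPQueriesFP.lean` (parameters, tape, point lists) on the triple `(x, ρ, a)`:

* `valNI`, `yAtI` (first occurrence through `findIdxFP`), `chooseM_cap`/`chooseMC`/`dcNC`, `scWNC`,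
  `ptsI`, `ldtSumI`, `csNI`, `roundLHSI`, `chainNI`, `scValNI`, `descsI`/`aritiesI`, `yssNI`,
  `finalLHSI`, `decideNC`, and
  **`decideC : CodeFP (pairE strE (pairE strE strE)) bitE (fun t => decideOf M T t.1 t.2.1 t.2.2)`**
  under `CodeFP unE natE T` and `T n ≤ 2^{c_T n + c_T}`.

All proved; no named fact.

## References

* L. Babai, L. Fortnow, L. Levin, M. Szegedy, *Checking computations in polylogarithmic time*,
  STOC 1991, §5 (the verifier runs in polynomial time) [BFLS1991].
* S. Arora, B. Barak, *Computational Complexity: A Modern Approach*, CUP 2009, Def. 11.4, §1.3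
  [AroraBarakCC2009].
-/

noncomputable section

open Finset Polynomial

namespace Literature.Computability.Complexity

namespace ScaledPCP

open CodeFP Turing Tableau TableauCSP AlgebraicPCP LowDegreeTest ModArith TabEval _root_.Computability

attribute [local instance] Turing.FinTM2.kFin Turing.FinTM2.ΛFin Turing.FinTM2.σFin
  Turing.FinTM2.Γk₀Fin

/-! ### Binomials, difference coefficients, weights (no carrier) -/

/-- A product with a zero factor vanishes modulo `p`. [folklore] -/
theorem prodM_eq_zero_of_mem {p : ℕ} {l : List ℕ} (h : 0 ∈ l) : prodM p l = 0 := by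
  rw [prodM_eq, List.prod_eq_zero h, Nat.zero_mod]

/-- **`chooseM` may cap its loop at `n + 1`** (beyond, the factor `t = n` vanishes). [folklore] -/
theorem chooseM_cap (p n j : ℕ) : chooseM p n j = chooseM p n (min j (n + 1)) := by
  rcases le_total j (n + 1) with h | h
  · rw [min_eq_left h]
  · rw [min_eq_right h]
    have hz : ∀ j', n + 1 ≤ j' → chooseM p n j' = 0 := fun j' hj' =>
      prodM_eq_zero_of_mem (List.mem_map.2 ⟨n, List.mem_range.2 (by omega), by simp [mulM]⟩)
    rw [hz j h, hz (n + 1) le_rfl]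

/-- **`chooseM` off `(p, (1ⁿ, j))`.** [folklore] -/
theorem chooseMC : CodeFP (pairE natE (pairE unE natE)) natE (fun t => chooseM t.1 t.2.1 t.2.2) := by
  -- context `(p, n)`, item `t`
  have hI : CodeFP (pairE (pairE natE natE) natE) natE (fun s => mulM s.1.1 (s.1.2 - s.2) (invM s.1.1 (s.2 + 1))) :=
    modMul (CodeFP.fst _ _).fst' (natSub.comp ((CodeFP.fst _ _).snd'.pair (CodeFP.snd _ _)))
      (modInv (CodeFP.fst _ _).fst' (natAdd.comp ((CodeFP.snd _ _).pair (CodeFP.const _ 1))))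
  have hj : CodeFP (pairE natE (pairE unE natE)) unE (fun t => min t.2.2 (t.2.1 + 1)) :=
    unOfNatMin.comp ((unSucc.comp (CodeFP.snd _ _).fst').pair (CodeFP.snd _ _).snd')
  have hctx : CodeFP (pairE natE (pairE unE natE)) (pairE natE natE) (fun t => (t.1, t.2.1)) :=
    (CodeFP.fst _ _).pair (natOfUn.comp (CodeFP.snd _ _).fst')
  refine ((modProd (CodeFP.fst _ _) ((CodeFP.map hI).comp (hctx.pair (urange.comp hj)))).congr fun t => ?_)
  dsimp only
  rw [chooseM_cap t.1 t.2.1 t.2.2]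
  rfl

/-- **`dcN` off `(p, (1ᵈ, j))`.** [folklore] -/
theorem dcNC : CodeFP (pairE natE (pairE unE natE)) natE (fun t => dcN t.1 t.2.1 t.2.2) := by
  have hpar : CodeFP (pairE natE (pairE unE natE)) bitE (fun t => decide ((t.2.1 + 1 - t.2.2) % 2 = 0)) :=
    natEq.comp ((natMod.comp ((natSub.comp ((natOfUn.comp (unSucc.comp (CodeFP.snd _ _).fst')).pair (CodeFP.snd _ _).snd')).pair
      (CodeFP.const _ 2))).pair (CodeFP.const _ 0))
  have hch : CodeFP (pairE natE (pairE unE natE)) natE (fun t => chooseM t.1 (t.2.1 + 1) t.2.2) :=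
    (chooseMC.comp ((CodeFP.fst _ _).pair ((unSucc.comp (CodeFP.snd _ _).fst').pair (CodeFP.snd _ _).snd'))).congr fun _ => rfl
  refine ((hpar.ite hch (modNeg (CodeFP.fst _ _) hch)).congr fun t => ?_)
  dsimp only [dcN]
  by_cases h : (t.2.1 + 1 - t.2.2) % 2 = 0 <;> simp [h]

/-- **The self-correction weight `scWN` off `((p, 1ᵈ), i)`.** [folklore] -/
theorem scWNC : CodeFP (pairE (pairE natE unE) natE) natE (fun t => scWN t.1.1 t.1.2 t.2) := by
  -- context `(p, i)`, item `j`
  have hP : CodeFP (pairE (pairE natE natE) natE) natE (fun s => s.1.1) := (CodeFP.fst _ _).fst'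
  have hterm : CodeFP (pairE (pairE natE natE) natE) natE
      (fun s => mulM s.1.1 (invM s.1.1 (subM s.1.1 (s.1.2 + 1) (s.2 + 1))) (negM s.1.1 (s.2 + 1))) :=
    modMul hP (modInv hP (modSub hP (natAdd.comp ((CodeFP.fst _ _).snd'.pair (CodeFP.const _ 1)))
      (natAdd.comp ((CodeFP.snd _ _).pair (CodeFP.const _ 1))))) (modNeg hP (natAdd.comp ((CodeFP.snd _ _).pair (CodeFP.const _ 1))))
  have hone : CodeFP (pairE (pairE natE natE) natE) natE (fun s => 1 % s.1.1) := modOf hP (CodeFP.const _ 1)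
  have heq : CodeFP (pairE (pairE natE natE) natE) bitE (fun s => decide (s.2 = s.1.2)) := natEq.comp ((CodeFP.snd _ _).pair (CodeFP.fst _ _).snd')
  have hI := heq.ite hone hterm
  refine ((modProd (CodeFP.fst _ _).fst' ((CodeFP.map hI).comp ((((CodeFP.fst _ _).fst').pair (CodeFP.snd _ _)).pair
    (urange.comp (unSucc.comp (CodeFP.fst _ _).snd'))))).congr fun t => ?_)
  unfold scWN
  dsimp only
  congr 1
  apply List.map_congr_left
  intro j _
  by_cases h : j = t.2 <;> simp [h]

/-! ### Off the triple `(x, ρ, a)`, through any carrier -/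

section FP

variable (M : TM2ComputableAux Bool Bool) (T : ℕ → ℕ) (hTc : CodeFP unE natE T) (cT : ℕ) (hTb : ∀ n, T n ≤ 2 ^ (cT * n + cT))
variable {κ : Type} {eκ : κ → List Bool} {X : κ → List Bool × List Bool × List Bool}

local notation "inE" => pairE strE strE
local notation "inE3" => pairE strE (pairE strE strE)
local notation "d" => dM M

/-- The pair `(x, ρ)` of the triple. [folklore] -/
theorem pairOf (hX : CodeFP eκ inE3 X) : CodeFP eκ inE (fun k => ((X k).1, (X k).2.1)) := hX.fst'.pair hX.snd'.fst'

include hTc hTb in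
/-- `d` in unary. [folklore] -/
theorem dNU : CodeFP unE unE (dN M T) :=
  unaryOf M cT (dNC M T hTc) fun n => by have := (params_le_WW M T cT hTb n).2.2.1; omega

/-- `drop` on strings by a binary count. [folklore] -/
theorem strDropNat : CodeFP (pairE natE strE) strE (fun t => t.2.drop t.1) := by
  have hu : CodeFP (pairE natE strE) unE (fun t => min t.1 t.2.length) :=
    unOfNatMin.comp ((strLength.comp (CodeFP.snd _ _)).pair (CodeFP.fst _ _))
  refine ((strDrop.comp (hu.pair (CodeFP.snd _ _)))).congr fun t => ?_
  dsimp only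
  rcases le_total t.1 t.2.length with h | h
  · rw [min_eq_left h]
  · rw [min_eq_right h, List.drop_eq_nil_of_le h, List.drop_eq_nil_of_le le_rfl]

include hTc hTb in
/-- **An answer block mod `p`** at a computed offset. [folklore] -/
theorem valNI (hX : CodeFP eκ inE3 X) {O : κ → ℕ} (hO : CodeFP eκ natE O) :
    CodeFP eκ natE (fun k => valN M T (X k).1 (X k).2.2 (O k)) :=
  (natMod.comp ((strVal.comp (strTake.comp ((ofLen (b0U M T hTc cT hTb) (pairOf hX)).pair (strDropNat.comp (hO.pair hX.snd'.snd'))))).pair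
    (ofLen (pNC M T hTc cT hTb) (pairOf hX)))).congr fun _ => by dsimp only [valN]

include hTc hTb in
/-- **The rebuilt oracle at a computed residue point of a computed list.** [folklore] -/
theorem yAtI (hX : CodeFP eκ inE3 X) {Ps : κ → List (List ℕ)} (hPs : CodeFP eκ (rawE (rawE natE)) Ps) {W : κ → List ℕ}
    (hW : CodeFP eκ (rawE natE) W) : CodeFP eκ natE (fun k => yAtN M T (X k).1 (X k).2.2 (Ps k) (W k)) := by
  have hbeq : CodeFP (pairE (rawE natE) (rawE natE)) bitE (fun s => s.2 == s.1) :=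
    (CodeFP.beq (rawE_injective natE_injective)).comp ((CodeFP.snd _ _).pair (CodeFP.fst _ _))
  have hidx : CodeFP eκ natE (fun k => (Ps k).idxOf (W k)) := ((findIdxFP hbeq).comp (hW.pair hPs)).congr fun _ => rfl
  exact (valNI M T hTc cT hTb hX (natMul.comp (hidx.pair (ofLen (b0C M T hTc cT hTb) (pairOf hX))))).congr fun _ => by dsimp only [yAtN]

include hTc hTb in
/-- **All oracle points** off the triple. [folklore] -/
theorem ptsI (hX : CodeFP eκ inE3 X) : CodeFP eκ (rawE (rawE natE)) (fun k => ptsN M T (X k).1 (tvOf M T (X k).1 (X k).2.1)) :=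
  ((rawAppend (rawE natE)).comp ((ldtI M T hTc cT hTb (pairOf hX)).pair (scI M T hTc cT hTb (pairOf hX)))).congr fun _ => rfl

include hTc hTb in
/-- **The test sum of a computed test index.** [cite: RubinfeldSudan1996, §4] -/
theorem ldtSumI (hX : CodeFP eκ inE3 X) {I : κ → ℕ} (hI : CodeFP eκ natE I) :
    CodeFP eκ natE (fun k => ldtSumN M T (X k).1 (X k).2.2 (tvOf M T (X k).1 (X k).2.1) (I k)) := by
  -- carrier `(k, j)`
  have hX1 : CodeFP (pairE eκ natE) inE3 (fun s => X s.1) := hX.comp (CodeFP.fst _ _)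
  have hp1 := ofLen (pNC M T hTc cT hTb) (pairOf hX1)
  have hpt : CodeFP (pairE eκ natE) (rawE natE) (fun s => linPtN (pN M T (X s.1).1.length)
      (testX (KN M T (X s.1).1.length) (mN M T (X s.1).1.length) (tvOf M T (X s.1).1 (X s.1).2.1) (I s.1))
      (testT (KN M T (X s.1).1.length) (mN M T (X s.1).1.length) (tvOf M T (X s.1).1 (X s.1).2.1) (I s.1)) s.2) :=
    linPtI hp1 (testXI M T hTc cT hTb (pairOf hX1) (hI.comp (CodeFP.fst _ _))) (testTI M T hTc cT hTb (pairOf hX1) (hI.comp (CodeFP.fst _ _)))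
      (CodeFP.snd _ _)
  have hterm : CodeFP (pairE eκ natE) natE (fun s => mulM (pN M T (X s.1).1.length) (dcN (pN M T (X s.1).1.length) (dN M T (X s.1).1.length) s.2)
      (yAtN M T (X s.1).1 (X s.1).2.2 (ptsN M T (X s.1).1 (tvOf M T (X s.1).1 (X s.1).2.1)) (linPtN (pN M T (X s.1).1.length)
      (testX (KN M T (X s.1).1.length) (mN M T (X s.1).1.length) (tvOf M T (X s.1).1 (X s.1).2.1) (I s.1))
      (testT (KN M T (X s.1).1.length) (mN M T (X s.1).1.length) (tvOf M T (X s.1).1 (X s.1).2.1) (I s.1)) s.2))) :=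
    modMul hp1 ((dcNC.comp (hp1.pair ((ofLen (dNU M T hTc cT hTb) (pairOf hX1)).pair (CodeFP.snd _ _)))).congr fun _ => rfl)
      (yAtI M T hTc cT hTb hX1 (ptsI M T hTc cT hTb hX1) hpt)
  exact (modSum (ofLen (pNC M T hTc cT hTb) (pairOf hX)) ((CodeFP.map hterm).comp ((CodeFP.id _).pair
    (urange.comp (ofLen (dN2U M T hTc cT hTb) (pairOf hX)))))).congr fun _ => by dsimp only [ldtSumN, id_eq]

include hTc hTb in
/-- **The coefficient residues of a computed message index.** [folklore] -/
theorem csNI (hX : CodeFP eκ inE3 X) {I : κ → ℕ} (hI : CodeFP eκ natE I) :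
    CodeFP eκ (rawE natE) (fun k => csN M T (X k).1 (X k).2.2 (tvOf M T (X k).1 (X k).2.1) (I k)) := by
  have hX1 : CodeFP (pairE eκ natE) inE3 (fun s => X s.1) := hX.comp (CodeFP.fst _ _)
  have hb0 := ofLen (b0C M T hTc cT hTb) (pairOf hX1)
  have hD1 : CodeFP (pairE eκ natE) natE (fun s => DN M T (X s.1).1.length + 1) :=
    natAdd.comp ((ofLen (DNC M T hTc) (pairOf hX1)).pair (CodeFP.const _ 1))
  have hoff : CodeFP (pairE eκ natE) natE (fun s => (ptsN M T (X s.1).1 (tvOf M T (X s.1).1 (X s.1).2.1)).length * b0 M T (X s.1).1.length +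
      (I s.1 * (DN M T (X s.1).1.length + 1) + s.2) * b0 M T (X s.1).1.length) :=
    (natAdd.comp ((natMul.comp (((natOfUn.comp ((ulength (rawE natE)).comp (ptsI M T hTc cT hTb hX1))).pair hb0))).pair
      (natMul.comp ((natAdd.comp ((natMul.comp ((hI.comp (CodeFP.fst _ _)).pair hD1)).pair (CodeFP.snd _ _))).pair hb0)))).congr
      fun _ => by dsimp only [id_eq]
  exact ((CodeFP.map (valNI M T hTc cT hTb hX1 hoff)).comp ((CodeFP.id _).pair (urange.comp (ofLen (DN1U M T hTc cT hTb) (pairOf hX))))).congr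
    fun _ => by dsimp only [csN, id_eq]

include hTc hTb in
/-- **The round sum of a computed round index.** [cite: AroraBarakCC2009, §8.3.2] -/
theorem roundLHSI (hX : CodeFP eκ inE3 X) {I : κ → ℕ} (hI : CodeFP eκ natE I) :
    CodeFP eκ natE (fun k => roundLHS M T (X k).1 (X k).2.2 (tvOf M T (X k).1 (X k).2.1) (I k)) := by
  have hX1 : CodeFP (pairE eκ natE) inE3 (fun s => X s.1) := hX.comp (CodeFP.fst _ _)
  have hterm : CodeFP (pairE eκ natE) natE (fun s => evalM (pN M T (X s.1).1.length) s.2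
      (csN M T (X s.1).1 (X s.1).2.2 (tvOf M T (X s.1).1 (X s.1).2.1) (I s.1))) :=
    (evalMod.comp (((ofLen (pNC M T hTc cT hTb) (pairOf hX1)).pair (CodeFP.snd _ _)).pair (csNI M T hTc cT hTb hX1 (hI.comp (CodeFP.fst _ _))))).congr
      fun _ => rfl
  exact (modSum (ofLen (pNC M T hTc cT hTb) (pairOf hX)) ((CodeFP.map hterm).comp ((CodeFP.id _).pair
    (urange.comp (ofLen (hNU M T cT hTb) (pairOf hX)))))).congr fun _ => by dsimp only [roundLHS, id_eq]

include hTc hTb in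
/-- **The chained claim of a computed index.** [cite: AroraBarakCC2009, §8.3.2] -/
theorem chainNI (hX : CodeFP eκ inE3 X) {I : κ → ℕ} (hI : CodeFP eκ natE I) :
    CodeFP eκ natE (fun k => chainN M T (X k).1 (X k).2.2 (tvOf M T (X k).1 (X k).2.1) (I k)) := by
  have hI1 : CodeFP eκ natE (fun k => I k - 1) := natSub.comp (hI.pair (CodeFP.const _ 1))
  have hr : CodeFP eκ natE (fun k => (rN (KN M T (X k).1.length) (tvOf M T (X k).1 (X k).2.1)).getD (I k - 1) 0) :=
    ((rawGetD natE natE_zero).comp ((rNI M T hTc cT hTb (pairOf hX)).pair hI1)).congr fun _ => rfl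
  have hev : CodeFP eκ natE (fun k => evalM (pN M T (X k).1.length) ((rN (KN M T (X k).1.length) (tvOf M T (X k).1 (X k).2.1)).getD (I k - 1) 0)
      (csN M T (X k).1 (X k).2.2 (tvOf M T (X k).1 (X k).2.1) (I k - 1))) :=
    (evalMod.comp (((ofLen (pNC M T hTc cT hTb) (pairOf hX)).pair hr).pair (csNI M T hTc cT hTb hX hI1))).congr fun _ => rfl
  have hz : CodeFP eκ bitE (fun k => decide (I k = 0)) := natEq.comp (hI.pair (CodeFP.const _ 0))
  exact ((hz.ite (CodeFP.const _ 0) hev)).congr fun k => by unfold chainN; by_cases h : I k = 0 <;> simp [h]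

include hTc hTb in
/-- **The self-corrected value of a computed read index.** [cite: AroraBarakCC2009, §8.6.2] -/
theorem scValNI (hX : CodeFP eκ inE3 X) {Q : κ → ℕ} (hQ : CodeFP eκ natE Q) :
    CodeFP eκ natE (fun k => scValN M T (X k).1 (X k).2.2 (tvOf M T (X k).1 (X k).2.1) (Q k)) := by
  -- carrier `(k, i)`
  have hX1 : CodeFP (pairE eκ natE) inE3 (fun s => X s.1) := hX.comp (CodeFP.fst _ _)
  have hp1 := ofLen (pNC M T hTc cT hTb) (pairOf hX1)
  have hpt : CodeFP (pairE eκ natE) (rawE natE) (fun s => linPtN (pN M T (X s.1).1.length)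
      (rdPtN M T (X s.1).1 (tvOf M T (X s.1).1 (X s.1).2.1) (Q s.1))
      (dirN (KN M T (X s.1).1.length) (mN M T (X s.1).1.length) (TtN M T (X s.1).1.length) (tvOf M T (X s.1).1 (X s.1).2.1) (Q s.1)) (s.2 + 1)) :=
    linPtI hp1 (rdPtI M T hTc cT hTb (pairOf hX1) (hQ.comp (CodeFP.fst _ _))) (dirNI M T hTc cT hTb (pairOf hX1) (hQ.comp (CodeFP.fst _ _)))
      (natAdd.comp ((CodeFP.snd _ _).pair (CodeFP.const _ 1)))
  have hw : CodeFP (pairE eκ natE) natE (fun s => scWN (pN M T (X s.1).1.length) (dN M T (X s.1).1.length) s.2) :=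
    (scWNC.comp ((hp1.pair (ofLen (dNU M T hTc cT hTb) (pairOf hX1))).pair (CodeFP.snd _ _))).congr fun _ => rfl
  have hterm := modMul hp1 (yAtI M T hTc cT hTb hX1 (ptsI M T hTc cT hTb hX1) hpt) hw
  exact (modSum (ofLen (pNC M T hTc cT hTb) (pairOf hX)) ((CodeFP.map hterm).comp ((CodeFP.id _).pair
    (urange.comp (ofLen (dN1U M T hTc cT hTb) (pairOf hX)))))).congr fun _ => by dsimp only [scValN, id_eq]

include hTc in
/-- **The descriptor list** off the triple. [folklore] -/
theorem descsI (hX : CodeFP eκ inE3 X) : CodeFP eκ (rawE fdE) (fun k => descs M (X k).1.length 0 (T (X k).1.length) (X k).1) :=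
  ((descsC M).comp ((((natOfUn.comp strLength).comp hX.fst').pair ((CodeFP.const _ 0).pair (ofLen hTc (pairOf hX)))).pair hX.fst')).congr
    fun _ => rfl

include hTc in
/-- **The arities** off the triple. [folklore] -/
theorem aritiesI (hX : CodeFP eκ inE3 X) : CodeFP eκ (rawE natE) (fun k => aritiesN M T (X k).1) :=
  ((map₀ ((natOfUn.comp (ulength rdE)).comp (CodeFP.snd _ _).fst')).comp (descsI M T hTc hX)).congr fun _ => by dsimp only [aritiesN, id_eq]

include hTc hTb in
/-- **The table of self-corrected reads** off the triple. [folklore] -/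
theorem yssNI (hX : CodeFP eκ inE3 X) : CodeFP eκ (rawE (rawE natE)) (fun k => yssN M T (X k).1 (X k).2.2 (tvOf M T (X k).1 (X k).2.1)) := by
  -- carrier `(k, φ)`
  have hX1 : CodeFP (pairE eκ natE) inE3 (fun s => X s.1) := hX.comp (CodeFP.fst _ _)
  have har := aritiesI M T hTc hX1
  have hflat : CodeFP (pairE eκ natE) (rawE natE) (fun s => (List.range (2 * (X s.1).1.length + cQ M)).map
      (scValN M T (X s.1).1 (X s.1).2.2 (tvOf M T (X s.1).1 (X s.1).2.1))) := by
    have hX2 : CodeFP (pairE (pairE eκ natE) natE) inE3 (fun s => X s.1.1) := hX1.comp (CodeFP.fst _ _)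
    exact ((CodeFP.map (scValNI M T hTc cT hTb hX2 (CodeFP.snd _ _))).comp ((CodeFP.id _).pair
      (urange.comp (ofLen (nQryU M T cT hTb) (pairOf hX1))))).congr fun _ => rfl
  have hoff : CodeFP (pairE eκ natE) natE (fun s => ((aritiesN M T (X s.1).1).take s.2).sum) :=
    (natSum.comp ((rawTakeNat natE).comp ((CodeFP.snd _ _).pair har))).congr fun _ => rfl
  have hlen : CodeFP (pairE eκ natE) natE (fun s => (aritiesN M T (X s.1).1).getD s.2 0) :=
    ((rawGetD natE natE_zero).comp (har.pair (CodeFP.snd _ _))).congr fun _ => rfl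
  have hblk : CodeFP (pairE eκ natE) (rawE natE) (fun s => ((((List.range (2 * (X s.1).1.length + cQ M)).map
      (scValN M T (X s.1).1 (X s.1).2.2 (tvOf M T (X s.1).1 (X s.1).2.1))).drop (((aritiesN M T (X s.1).1).take s.2).sum)).take
      ((aritiesN M T (X s.1).1).getD s.2 0))) :=
    ((rawTakeNat natE).comp (hlen.pair ((rawDropNat' natE).comp (hoff.pair hflat)))).congr fun _ => rfl
  exact ((CodeFP.map hblk).comp ((CodeFP.id _).pair (urange.comp ((ulength natE).comp (aritiesI M T hTc hX))))).congr
    fun _ => by dsimp only [yssN, id_eq]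

/-- Building the parameter record from its tuple. [folklore] -/
theorem mkPrmC : CodeFP tupE prmE (fun t => (⟨t.1, t.2.1, t.2.2.1, t.2.2.2.1, t.2.2.2.2.1, t.2.2.2.2.2.1, t.2.2.2.2.2.2⟩ : Prm)) :=
  CodeFP.transparent fun _ => rfl

include hTc hTb in
/-- **The final value** off the triple. [cite: BFLS1991, §5] -/
theorem finalLHSI (hX : CodeFP eκ inE3 X) : CodeFP eκ natE (fun k => finalLHS M T (X k).1 (X k).2.2 (tvOf M T (X k).1 (X k).2.1)) := by
  have hx := pairOf hX
  have hp := ofLen (pNC M T hTc cT hTb) hx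
  have hprm : CodeFP eκ prmE (fun k => (⟨pN M T (X k).1.length, hN M (X k).1.length, ktN M T (X k).1.length, kJN M T (X k).1.length,
      (X k).1.length, 0, T (X k).1.length⟩ : Prm)) :=
    (mkPrmC.comp (hp.pair ((ofLen (hNU M T cT hTb) hx).pair ((ofLen (ktNU M T hTc cT hTb) hx).pair ((ofLen (kJNU M T hTc cT hTb) hx).pair
      (((natOfUn.comp strLength).comp hX.fst').pair ((CodeFP.const _ 0).pair (ofLen hTc hx)))))))).congr fun _ => rfl
  have hpsi := (psiNC d).comp (hprm.pair ((seedNI M T hTc cT hTb hx).pair ((rNI M T hTc cT hTb hx).pair ((yssNI M T hTc cT hTb hX).pair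
    (descsI M T hTc hX)))))
  have hker := kernelNC.comp ((hp.pair (ofLen (hNU M T cT hTb) hx)).pair ((rNI M T hTc cT hTb hx).pair (rhoNI M T hTc cT hTb hx)))
  refine (modMul hp hpsi hker).congr fun k => ?_
  unfold finalLHS
  dsimp only [Function.comp_apply]
  rw [show p1 (pN M T (X k).1.length) = pN M T (X k).1.length from max_eq_left (by have := two_le_pN M T (X k).1.length; omega)]

include hTc hTb in
/-- **The residue-level decision off the triple.** [cite: BFLS1991, §5] -/
theorem decideNC : CodeFP inE3 bitE (fun t => decideN M T t.1 t.2.1 t.2.2) := by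
  have hX : CodeFP inE3 inE3 (fun t => t) := CodeFP.id _
  have hflag : CodeFP inE3 bitE (fun t => (coinParse (bN M T t.1.length) (pN M T t.1.length) (kT M T t.1) t.2.1).1) :=
    (parseI M T hTc cT hTb (pairOf hX)).fst'
  -- carrier `(t, i)`
  have hX1 : CodeFP (pairE inE3 natE) inE3 (fun s => s.1) := CodeFP.fst _ _
  have hldt : CodeFP (pairE inE3 natE) bitE (fun s => ldtSumN M T s.1.1 s.1.2.2 (tvOf M T s.1.1 s.1.2.1) s.2 == 0) :=
    (CodeFP.beq natE_injective).comp ((ldtSumI M T hTc cT hTb hX1 (CodeFP.snd _ _)).pair (CodeFP.const _ 0))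
  have hrnd : CodeFP (pairE inE3 natE) bitE (fun s => roundLHS M T s.1.1 s.1.2.2 (tvOf M T s.1.1 s.1.2.1) s.2 ==
      chainN M T s.1.1 s.1.2.2 (tvOf M T s.1.1 s.1.2.1) s.2) :=
    (CodeFP.beq natE_injective).comp ((roundLHSI M T hTc cT hTb hX1 (CodeFP.snd _ _)).pair (chainNI M T hTc cT hTb hX1 (CodeFP.snd _ _)))
  have hfin : CodeFP inE3 bitE (fun t => finalLHS M T t.1 t.2.2 (tvOf M T t.1 t.2.1) == chainN M T t.1 t.2.2 (tvOf M T t.1 t.2.1) (KN M T t.1.length)) :=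
    (CodeFP.beq natE_injective).comp ((finalLHSI M T hTc cT hTb hX).pair (chainNI M T hTc cT hTb hX (ofLen (KNC M T hTc) (pairOf hX))))
  have hall1 := (CodeFP.all hldt).comp ((CodeFP.id _).pair (urange.comp (ofLen (TtNU M T hTc cT hTb) (pairOf hX))))
  have hall2 := (CodeFP.all hrnd).comp ((CodeFP.id _).pair (urange.comp (ofLen (KNU M T hTc cT hTb) (pairOf hX))))
  exact (hflag.ite ((hall1.and hall2).and hfin) (CodeFP.const _ true)).congr fun t => by unfold decideN; dsimp only [id_eq]

include hTc hTb in
/-- **The decision map of the scaled PCP verifier is polynomial time.** [cite: BFLS1991, §5]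
[cite: AroraBarakCC2009, Def. 11.4] -/
theorem decideC : CodeFP inE3 bitE (fun t => decideOf M T t.1 t.2.1 t.2.2) :=
  (decideNC M T hTc cT hTb).congr fun t => (decideOf_eq_decideN M T t.2.1 t.2.2 (x := t.1)).symm

end FP

end ScaledPCP

end Literature.Computability.Complexity

end
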